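import Literature.NumberTheory.Transcendental.SemialgebraicMapsProofs
import Literature.NumberTheory.Transcendental.KZIntervalPeriodProofs
import Mathlib

/-! BC5 / cheapest-falsifier instance for `stub_monomialPatches` (and the typing of X₁): n = 2,
σ = C = (0,1)², p = 1, q = X₀ + X₁ (corner pole at the origin, density `1/(x+y)`): the two blow-up
charts φ₁ (x,t) = (x, x t) and φ₂ (t,y) = (t y, y) of the open unit square, units `1/(1+t)`,
exponents 0, cover `C` off the diagonal. No sorry. -/

noncomputable section
open MeasureTheory Set
open Literature.NumberTheory.Transcendental Literature.ModelTheory.ExponentialFields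

namespace Summit.KontsevichZagierPeriods.VeryGoodTransfer.MonomialPatchesDim2

theorem isSemialgebraic_cube2 : IsSemialgebraic ℚ {x : Fin 2 → ℝ | ∀ j, 0 < x j ∧ x j < 1} := by
  have : {x : Fin 2 → ℝ | ∀ j, 0 < x j ∧ x j < 1} =
      ⋂ j ∈ (Finset.univ : Finset (Fin 2)),
        ({x : Fin 2 → ℝ | 0 < MvPolynomial.aeval x (MvPolynomial.X j : MvPolynomial (Fin 2) ℚ)} ∩
          {x : Fin 2 → ℝ | 0 < MvPolynomial.aeval x (1 - MvPolynomial.X j : MvPolynomial (Fin 2) ℚ)}) := by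
    ext x; simp [sub_pos]
  rw [this]
  exact IsSemialgebraic.biInter _ _ fun j _ =>
    (isSemialgebraic_setOf_eval_pos _).inter (isSemialgebraic_setOf_eval_pos _)

/-- chart 1: `(x, t) ↦ (x, x t)`. -/
def φ₁ : (Fin 2 → ℝ) → (Fin 2 → ℝ) := fun v => ![v 0, v 0 * v 1]
/-- chart 2: `(t, y) ↦ (t y, y)`. -/
def φ₂ : (Fin 2 → ℝ) → (Fin 2 → ℝ) := fun v => ![v 0 * v 1, v 1]

/-- derivative of chart 1. -/
def φ₁' (v : Fin 2 → ℝ) : (Fin 2 → ℝ) →L[ℝ] (Fin 2 → ℝ) :=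
  ContinuousLinearMap.pi ![ContinuousLinearMap.proj 0,
    v 0 • ContinuousLinearMap.proj 1 + v 1 • ContinuousLinearMap.proj 0]
/-- derivative of chart 2. -/
def φ₂' (v : Fin 2 → ℝ) : (Fin 2 → ℝ) →L[ℝ] (Fin 2 → ℝ) :=
  ContinuousLinearMap.pi ![v 0 • ContinuousLinearMap.proj 1 + v 1 • ContinuousLinearMap.proj 0,
    ContinuousLinearMap.proj 1]

theorem hasFDerivAt_φ₁ (v : Fin 2 → ℝ) : HasFDerivAt φ₁ (φ₁' v) v := by
  refine hasFDerivAt_pi'' (Fin.forall_fin_two.2 ⟨?_, ?_⟩)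
  · have hf : (fun x : Fin 2 → ℝ => φ₁ x 0) = fun x => x 0 := by funext x; simp [φ₁]
    rw [hf]
    refine (hasFDerivAt_apply (𝕜 := ℝ) (0 : Fin 2) v).congr_fderiv ?_
    ext w
    simp [φ₁']
  · have hf : (fun x : Fin 2 → ℝ => φ₁ x 1) = ((fun f : Fin 2 → ℝ => f 0) * fun f => f 1) := by
      funext x; simp [φ₁]
    rw [hf]
    refine ((hasFDerivAt_apply (𝕜 := ℝ) (0 : Fin 2) v).mul
      (hasFDerivAt_apply (𝕜 := ℝ) (1 : Fin 2) v)).congr_fderiv ?_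
    ext w
    simp [φ₁']

theorem hasFDerivAt_φ₂ (v : Fin 2 → ℝ) : HasFDerivAt φ₂ (φ₂' v) v := by
  refine hasFDerivAt_pi'' (Fin.forall_fin_two.2 ⟨?_, ?_⟩)
  · have hf : (fun x : Fin 2 → ℝ => φ₂ x 0) = ((fun f : Fin 2 → ℝ => f 0) * fun f => f 1) := by
      funext x; simp [φ₂]
    rw [hf]
    refine ((hasFDerivAt_apply (𝕜 := ℝ) (0 : Fin 2) v).mul
      (hasFDerivAt_apply (𝕜 := ℝ) (1 : Fin 2) v)).congr_fderiv ?_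
    ext w
    simp [φ₂']
  · have hf : (fun x : Fin 2 → ℝ => φ₂ x 1) = fun x => x 1 := by funext x; simp [φ₂]
    rw [hf]
    refine (hasFDerivAt_apply (𝕜 := ℝ) (1 : Fin 2) v).congr_fderiv ?_
    ext w
    simp [φ₂']

theorem det_φ₁' (v : Fin 2 → ℝ) : (φ₁' v).det = v 0 := by
  rw [ContinuousLinearMap.det, ← LinearMap.det_toMatrix', Matrix.det_fin_two]
  simp [LinearMap.toMatrix'_apply, φ₁']

theorem det_φ₂' (v : Fin 2 → ℝ) : (φ₂' v).det = v 1 := by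
  rw [ContinuousLinearMap.det, ← LinearMap.det_toMatrix', Matrix.det_fin_two]
  simp [LinearMap.toMatrix'_apply, φ₂']

/-- The `n = 2` instance of the conclusion of `stub_monomialPatches` at `σ = C`, `p = 1`, `q = X₀ + X₁`. -/
theorem dim2_instance :
    ∃ (k : ℕ) (φ : Fin k → (Fin 2 → ℝ) → (Fin 2 → ℝ)) (φ' : Fin k → (Fin 2 → ℝ) → (Fin 2 → ℝ) →L[ℝ] (Fin 2 → ℝ)) (u : Fin k → (Fin 2 → ℝ) → ℝ) (U : Fin k → Set (Fin 2 → ℝ)) (a : Fin k → Fin 2 → ℤ), (∀ i, Literature.NumberTheory.Transcendental.IsSemialgebraicMapOn ℚ {x : Fin 2 → ℝ | ∀ j, 0 < x j ∧ x j < 1} (φ i) ∧ (∀ x ∈ {x : Fin 2 → ℝ | ∀ j, 0 < x j ∧ x j < 1}, HasFDerivWithinAt (φ i) (φ' i x) {x : Fin 2 → ℝ | ∀ j, 0 < x j ∧ x j < 1} x) ∧ Set.InjOn (φ i) {x : Fin 2 → ℝ | ∀ j, 0 < x j ∧ x j < 1} ∧ φ i '' {x : Fin 2 → ℝ | ∀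 j, 0 < x j ∧ x j < 1} ⊆ {x : Fin 2 → ℝ | ∀ j, 0 < x j ∧ x j < 1} ∧ IsOpen (U i) ∧ closure {x : Fin 2 → ℝ | ∀ j, 0 < x j ∧ x j < 1} ⊆ U i ∧ ContDiffOn ℝ 1 (u i) (U i) ∧ (∀ x ∈ U i, u i x ≠ 0) ∧ Literature.NumberTheory.Transcendental.IsSemialgebraicFunOn ℚ {x : Fin 2 → ℝ | ∀ j, 0 < x j ∧ x j < 1} (u i) ∧ ∀ x ∈ {x : Fin 2 → ℝ | ∀ j, 0 < x j ∧ x j < 1}, MvPolynomial.aeval (φ i x) (1 : MvPolynomial (Fin 2) ℚ) / MvPolynomial.aeval (φ i x) (MvPolynomial.X 0 + MvPolynomial.X 1 : MvPolynomial (Fin 2) ℚ) * |(φ' i x).det| = u i x * ∏ j, x j ^ (a i j)) ∧ MeasureTheory.volume ({x : Fin 2 → ℝ | ∀ j, 0 < x j ∧ x j < 1} \ ⋃ i, φ i '' {x : Fin 2 → ℝ | ∀ j, 0 < x j ∧ x j < 1}) = 0 := by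
  have hCs := isSemialgebraic_cube2
  set C : Set (Fin 2 → ℝ) := {x | ∀ j, 0 < x j ∧ x j < 1} with hC
  have hcl : closure C ⊆ {v | ∀ j, 0 ≤ v j ∧ v j ≤ 1} := by
    refine closure_minimal (fun v hv j => ⟨(hv j).1.le, (hv j).2.le⟩) ?_
    have : {v : Fin 2 → ℝ | ∀ j, 0 ≤ v j ∧ v j ≤ 1} = Set.Icc 0 1 := by
      ext v; simp [Pi.le_def, forall_and]
    rw [this]; exact isClosed_Icc
  refine ⟨2, ![φ₁, φ₂], ![φ₁', φ₂'], ![fun v => (1 + v 1)⁻¹, fun v => (1 + v 0)⁻¹],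
    ![{v | 0 < 1 + v 1}, {v | 0 < 1 + v 0}], ![0, 0], ?_, ?_⟩
  · intro i
    fin_cases i
    · -- chart 1
      simp only [Fin.zero_eta, Fin.isValue, Matrix.cons_val_zero]
      refine ⟨?_, ?_, ?_, ?_, ?_, ?_, ?_, ?_, ?_, ?_⟩
      · refine (isSemialgebraicMapOn_aeval hCs ![MvPolynomial.X 0, MvPolynomial.X 0 * MvPolynomial.X 1]).congr ?_
        intro v _; ext i; fin_cases i <;> simp [φ₁]
      · intro v _; exact (hasFDerivAt_φ₁ v).hasFDerivWithinAt
      · intro v hv w hw h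
        have h0 : v 0 = w 0 := by simpa [φ₁] using congr_fun h 0
        have h1 : v 0 * v 1 = w 0 * w 1 := by simpa [φ₁] using congr_fun h 1
        rw [h0] at h1
        have h1' := mul_left_cancel₀ (hw 0).1.ne' h1
        ext i; fin_cases i
        · exact h0
        · exact h1'
      · rintro _ ⟨v, hv, rfl⟩ j
        fin_cases j
        · simpa [φ₁] using hv 0
        · simp only [φ₁, Fin.mk_one, Fin.isValue, Matrix.cons_val_one, Matrix.cons_val_fin_one]
          exact ⟨mul_pos (hv 0).1 (hv 1).1, mul_lt_one_of_nonneg_of_lt_one_left (hv 0).1.le (hv 0).2 (hv 1).2.le⟩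
      · exact isOpen_lt continuous_const (continuous_const.add (continuous_apply 1))
      · intro v hv
        have := (hcl hv 1).1
        show 0 < 1 + v 1
        linarith
      · exact (contDiffOn_const.add (contDiff_apply ℝ ℝ 1).contDiffOn).inv fun v hv => hv.ne'
      · intro v hv; exact inv_ne_zero hv.ne'
      · refine (isSemialgebraicFunOn_aeval_div_aeval hCs 1 (1 + MvPolynomial.X 1) fun v hv => ?_).congr ?_
        · have := (hv 1).1; simp; linarith
        · intro v _; simp
      · intro v hv
        have h0 : 0 < v 0 := (hv 0).1
        have h1 : 0 < v 1 := (hv 1).1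
        rw [det_φ₁']
        simp only [φ₁, map_one, map_add, MvPolynomial.aeval_X, Matrix.cons_val_zero, Matrix.cons_val_one,
          Matrix.cons_val_fin_one, Pi.zero_apply, zpow_zero, Finset.prod_const_one, mul_one, abs_of_pos h0]
        field_simp
    · -- chart 2
      simp only [Fin.mk_one, Fin.isValue, Matrix.cons_val_one, Matrix.cons_val_fin_one]
      refine ⟨?_, ?_, ?_, ?_, ?_, ?_, ?_, ?_, ?_, ?_⟩
      · refine (isSemialgebraicMapOn_aeval hCs ![MvPolynomial.X 0 * MvPolynomial.X 1, MvPolynomial.X 1]).congr ?_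
        intro v _; ext i; fin_cases i <;> simp [φ₂]
      · intro v _; exact (hasFDerivAt_φ₂ v).hasFDerivWithinAt
      · intro v hv w hw h
        have h1 : v 1 = w 1 := by simpa [φ₂] using congr_fun h 1
        have h0 : v 0 * v 1 = w 0 * w 1 := by simpa [φ₂] using congr_fun h 0
        rw [h1] at h0
        have h0' := mul_right_cancel₀ (hw 1).1.ne' h0
        ext i; fin_cases i
        · exact h0'
        · exact h1
      · rintro _ ⟨v, hv, rfl⟩ j
        fin_cases j
        · simp only [φ₂, Fin.zero_eta, Fin.isValue, Matrix.cons_val_zero]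
          exact ⟨mul_pos (hv 0).1 (hv 1).1, mul_lt_one_of_nonneg_of_lt_one_left (hv 0).1.le (hv 0).2 (hv 1).2.le⟩
        · simpa [φ₂] using hv 1
      · exact isOpen_lt continuous_const (continuous_const.add (continuous_apply 0))
      · intro v hv
        have := (hcl hv 0).1
        show 0 < 1 + v 0
        linarith
      · exact (contDiffOn_const.add (contDiff_apply ℝ ℝ 0).contDiffOn).inv fun v hv => hv.ne'
      · intro v hv; exact inv_ne_zero hv.ne'
      · refine (isSemialgebraicFunOn_aeval_div_aeval hCs 1 (1 + MvPolynomial.X 0) fun v hv => ?_).congr ?_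
        · have := (hv 0).1; simp; linarith
        · intro v _; simp
      · intro v hv
        have h0 : 0 < v 0 := (hv 0).1
        have h1 : 0 < v 1 := (hv 1).1
        rw [det_φ₂']
        simp only [φ₂, map_one, map_add, MvPolynomial.aeval_X, Matrix.cons_val_zero, Matrix.cons_val_one,
          Matrix.cons_val_fin_one, Pi.zero_apply, zpow_zero, Finset.prod_const_one, mul_one, abs_of_pos h1]
        field_simp
        ring
  · -- the two charts cover the square off the diagonal
    set L : (Fin 2 → ℝ) →ₗ[ℝ] ℝ :=
      (LinearMap.proj 0 : (Fin 2 → ℝ) →ₗ[ℝ] ℝ) - (LinearMap.proj 1 : (Fin 2 → ℝ) →ₗ[ℝ] ℝ) with hL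
    have hsub : C \ ⋃ i, (![φ₁, φ₂] : Fin 2 → (Fin 2 → ℝ) → (Fin 2 → ℝ)) i '' C ⊆ (L.ker : Set (Fin 2 → ℝ)) := by
      rintro v ⟨hv, hnot⟩
      simp only [hL, SetLike.mem_coe, LinearMap.mem_ker, LinearMap.sub_apply, LinearMap.coe_proj,
        Function.eval, sub_eq_zero]
      by_contra hne
      apply hnot
      rcases lt_or_gt_of_ne hne with hlt | hlt
      · -- v 0 < v 1: chart 2 with (v 0 / v 1, v 1)
        refine mem_iUnion.2 ⟨1, ?_⟩
        refine ⟨![v 0 / v 1, v 1], fun j => ?_, ?_⟩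
        · fin_cases j
          · simp only [Fin.zero_eta, Fin.isValue, Matrix.cons_val_zero]
            exact ⟨div_pos (hv 0).1 (hv 1).1, (div_lt_one (hv 1).1).2 hlt⟩
          · simpa using hv 1
        · have h1 : v 1 ≠ 0 := (hv 1).1.ne'
          ext i; fin_cases i <;> simp [φ₂] ; field_simp
      · -- v 1 < v 0: chart 1 with (v 0, v 1 / v 0)
        refine mem_iUnion.2 ⟨0, ?_⟩
        refine ⟨![v 0, v 1 / v 0], fun j => ?_, ?_⟩
        · fin_cases j
          · simpa using hv 0
          · simp only [Fin.mk_one, Fin.isValue, Matrix.cons_val_one, Matrix.cons_val_fin_one]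
            exact ⟨div_pos (hv 1).1 (hv 0).1, (div_lt_one (hv 0).1).2 hlt⟩
        · have h0 : v 0 ≠ 0 := (hv 0).1.ne'
          ext i; fin_cases i <;> simp [φ₁] ; field_simp
    have hker : L.ker ≠ ⊤ := by
      intro htop
      have : (Pi.single 0 1 : Fin 2 → ℝ) ∈ L.ker := by
        rw [htop]; exact Submodule.mem_top
      simp [hL, LinearMap.mem_ker] at this
    exact measure_mono_null hsub (Measure.addHaar_submodule volume _ hker)

end Summit.KontsevichZagierPeriods.VeryGoodTransfer.MonomialPatchesDim2
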